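import Summits.CriticalPhenomena.PercolationContinuityZ3.Theorems.Transplant.SkelPhiRectAt
import HarnessLib

/-!
# N1 ({±1} node) files (C-1)+(C-2) (hp-8 g31; R0 of the V112 trigger, 2026-08-21 11:42:57Z): the sheared-frame cell arithmetic over
# the Martineau–Tassion lattice `ℤ·A′u + ℤ·A′v` — exact dual coordinates `λ = adj(M)·x`, the coarse 1-Lipschitz skeleton `ρ`, the stride
# displacement model and its reading/steering lemmas, and the COARSE-STEPS device (NEG-NODE-F-SCOPE.md §10/§12, NEG-SCOPE.md v1.1 §4, addenda A / hp8 C1–C2 / P5-R2)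

builds on p205010 (kernel theorem, internal audit signed; external expert review pending) — nothing in this file uses p205010.
Lane `prim-bschramm`, seat `prim-hp-8` (gen 31); helper file (`--supports stmt-CriticalPhenomena-4575 --as helper`).  The V-level sheared height is p3-g8's
`Skelφ.shearCoord` (SkelPhiEquilibriumDefs, p265235): `lam1 A n h (φ w − φ t) = A · shearCoord φ t n h w` — the bridge lemma is filed separately once that olean is on the farm.

SETTING (integers throughout).  The equilibrium parallelogram of MT17 Lemma 3.5 at one stride scale: width `n ≥ 1`, integer shear `h`, half-height
`ℓ ≥ 1`, the sheared height `β′ := n·β − h·α` (so `C(n,h,ℓ) = {|α| ≤ n, |β′| ≤ n·ℓ}` exactly), the x-stride vector `u = (n, h)` and the top split point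
`v = (vα, vβ)` (a lattice point of the top layer: `|vα| ≤ n`, `m := n·vβ − h·vα ∈ (nℓ − n − |h|, nℓ]`).  With `A` (= A′) strides per cell the cell
lattice is `M = [A·u  A·v]`, `D := det M = A²·m`, and the EXACT dual coordinates are `λ₀ x = A(vβ x₀ − vα x₁)`, `λ₁ x = A·β′(x)` (`λ = adj(M)·x`):
both run families are axis-parallel in `λ`.  The COARSE coordinates `ρ_i := ⌊(c·λ_i + s)/D⌋` (`c = 20K`) are 1-Lipschitz along every φ-edge as soon as
`c·L_i ≤ D`, `L₀ = A(|vα| + |vβ|)`, `L₁ = A(n + |h|)` — so `PlanarCells2*` applies verbatim to `ρ ∘ φ` (NEG-NODE-F-SCOPE §10.2).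
* §1 `bp`, `modulus`, `lam0`, `lam1`, `detD`; the stride reading identities `lam_xstride`, `lam_ystride` (pure `ring`);
* §2 Lipschitz bounds `abs_lam0_sub_le`, `abs_lam1_sub_le`; the coarse map `coarse` and `abs_coarse_sub_le_one`; **`lip_coarse_comp`** (`Skelφ.Lip` for `ρ ∘ φ`);
* §3 steering: `steer_sym` (x-family, symmetric halves), `steer_pieces` (y′-family, pieces `[−(n+vα), 0]` / `[0, n−vα]`); the wobble bound `abs_slant_le`;
* §4 rounding `rdiv`, exact floor `ediv_eq_of_bounds`; §5 the CANONICAL REPRESENTATIVE `rep z` of coarse cell `z` with **`coarse_rep`** (`ρ(rep z) = z` once `c·L_i + 2 ≤ D`) and the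
  spacing bound `abs_rep_sub_rep_le`; §6 **`exists_mem_graphBall_φ_eq_rep`** (COARSE STEPS: a vertex at a prescribed coarse position near any vertex, from `Skelφ.Steps` via
  p3's `Skelφ.exists_mem_graphBall_φ_eq`) — the replacement of `rectCtr hstep` when a kit centre is sited by coarse position.
[cite: MartineauTassion2017, §3.2 Lemma 3.5, §4.1, §4.3 Lemma 4.2 (arXiv:1312.1946 pp. 9–14)] [cite: KozmaNitzan2024, §4 Lemma 11 (pp. 22–23)]
-/

namespace Summit.CriticalPhenomena.PercolationContinuityZ3.Theorems.Transplant

namespace TwoAxis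

namespace Para

open Literature.Probability.LatticeModels

/-! ## §1 The sheared height, the dual coordinates, the determinant, and the stride reading identities -/

/-- The sheared height `β′ = n·β − h·α` of a planar point (`x 0 = α`, `x 1 = β`). [cite: MartineauTassion2017, §3.2 (the parallelogram [a,b,−a,−b])] -/
def bp (n h : ℤ) (x : Site 2) : ℤ := n * x 1 - h * x 0

/-- The layer modulus `m = n·vβ − h·vα` of the top split point `v` (`= β′(v)`; `det(u,v)` of MT17 §4.1). [cite: MartineauTassion2017, §4.1] -/
def modulus (n h vα vβ : ℤ) : ℤ := n * vβ - h * vα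

/-- The first dual coordinate `λ₀ = A·(vβ·α − vα·β)` (position along `u`, `D` per cell). [this work] -/
def lam0 (A vα vβ : ℤ) (x : Site 2) : ℤ := A * (vβ * x 0 - vα * x 1)

/-- The second dual coordinate `λ₁ = A·β′` (sheared height, `D` per cell). [this work] -/
def lam1 (A n h : ℤ) (x : Site 2) : ℤ := A * bp n h x

/-- The determinant of the cell lattice `M = [A·u  A·v]`: `D = A²·m`. [cite: MartineauTassion2017, §4.1] -/
def detD (A n h vα vβ : ℤ) : ℤ := A ^ 2 * modulus n h vα vβ

/-- `D = det [A·u  A·v]` literally (`u = (n,h)`, `v = (vα,vβ)`). [folklore] -/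
theorem detD_eq (A n h vα vβ : ℤ) : detD A n h vα vβ = (A * n) * (A * vβ) - (A * vα) * (A * h) := by
  unfold detD modulus; ring

/-- `λ = adj(M)·x`: `M·λ(x) = D·x`, i.e. `(A n)·λ₀ + (A vα)·λ₁ = D·x₀` and `(A h)·λ₀ + (A vβ)·λ₁ = D·x₁`. [folklore] -/
theorem mul_lam_eq (A n h vα vβ : ℤ) (x : Site 2) :
    (A * n) * lam0 A vα vβ x + (A * vα) * lam1 A n h x = detD A n h vα vβ * x 0 ∧
      (A * h) * lam0 A vα vβ x + (A * vβ) * lam1 A n h x = detD A n h vα vβ * x 1 := by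
  unfold lam0 lam1 bp detD modulus; constructor <;> ring

/-- **Reading of an x-stride** (displacement `(n, h + j)`, `j` = the half offset): `λ₀` advances by `A·m − A·vα·j` (one stride `D/A = A·m` minus
the slant term) and `λ₁` by `A·n·j`. [cite: MartineauTassion2017, §4.3 Lemma 4.2] -/
theorem lam_xstride (A n h vα vβ j : ℤ) {x y : Site 2} (h0 : y 0 = x 0 + n) (h1 : y 1 = x 1 + h + j) :
    lam0 A vα vβ y - lam0 A vα vβ x = A * modulus n h vα vβ - A * vα * j ∧ lam1 A n h y - lam1 A n h x = A * n * j := by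
  unfold lam0 lam1 bp modulus; rw [h0, h1]; constructor <;> ring

/-- **Reading of a y′-stride** (landing in the top layer on a piece: `α` moves by `vα + ε`, `β′` by `n·ℓ − θ`): `λ₁` advances by `A(nℓ − θ)` and
`n·Δλ₀ = A(ε·m + vα(m − nℓ + θ))` (relative to the nominal `v`, an offset `ε` along u plus a layer term). [cite: MartineauTassion2017, §4.3 Lemma 4.2] -/
theorem lam_ystride (A n h ℓ vα vβ ε θ : ℤ) {x y : Site 2} (h0 : y 0 = x 0 + vα + ε)
    (hlayer : n * (y 1 - x 1) - h * (vα + ε) = n * ℓ - θ) :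
    lam1 A n h y - lam1 A n h x = A * (n * ℓ - θ) ∧
      n * (lam0 A vα vβ y - lam0 A vα vβ x) = A * (ε * modulus n h vα vβ + vα * (modulus n h vα vβ - n * ℓ + θ)) := by
  constructor
  · unfold lam1 bp
    have : n * y 1 - h * y 0 - (n * x 1 - h * x 0) = n * ℓ - θ := by rw [h0]; linear_combination hlayer
    linear_combination A * this
  · unfold lam0 modulus
    rw [h0]
    linear_combination (-(A * vα)) * hlayer

/-! ## §2 Lipschitz bounds and the coarse 1-Lipschitz skeleton -/

/-- `|λ₀ x − λ₀ y| ≤ |A|(|vβ| + |vα|)` when `x, y` differ by at most one in each coordinate. [folklore] -/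
theorem abs_lam0_sub_le (A vα vβ : ℤ) {x y : Site 2} (h0 : |x 0 - y 0| ≤ 1) (h1 : |x 1 - y 1| ≤ 1) :
    |lam0 A vα vβ x - lam0 A vα vβ y| ≤ |A| * (|vβ| + |vα|) := by
  have e : lam0 A vα vβ x - lam0 A vα vβ y = A * (vβ * (x 0 - y 0) - vα * (x 1 - y 1)) := by unfold lam0; ring
  rw [e, abs_mul]
  refine mul_le_mul_of_nonneg_left ?_ (abs_nonneg A)
  calc |vβ * (x 0 - y 0) - vα * (x 1 - y 1)| ≤ |vβ * (x 0 - y 0)| + |vα * (x 1 - y 1)| := abs_sub _ _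
    _ = |vβ| * |x 0 - y 0| + |vα| * |x 1 - y 1| := by rw [abs_mul, abs_mul]
    _ ≤ |vβ| * 1 + |vα| * 1 := by gcongr
    _ = |vβ| + |vα| := by ring

/-- `|λ₁ x − λ₁ y| ≤ |A|(|n| + |h|)` when `x, y` differ by at most one in each coordinate. [folklore] -/
theorem abs_lam1_sub_le (A n h : ℤ) {x y : Site 2} (h0 : |x 0 - y 0| ≤ 1) (h1 : |x 1 - y 1| ≤ 1) :
    |lam1 A n h x - lam1 A n h y| ≤ |A| * (|n| + |h|) := by
  have e : lam1 A n h x - lam1 A n h y = A * (n * (x 1 - y 1) - h * (x 0 - y 0)) := by unfold lam1 bp; ring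
  rw [e, abs_mul]
  refine mul_le_mul_of_nonneg_left ?_ (abs_nonneg A)
  calc |n * (x 1 - y 1) - h * (x 0 - y 0)| ≤ |n * (x 1 - y 1)| + |h * (x 0 - y 0)| := abs_sub _ _
    _ = |n| * |x 1 - y 1| + |h| * |x 0 - y 0| := by rw [abs_mul, abs_mul]
    _ ≤ |n| * 1 + |h| * 1 := by gcongr
    _ = |n| + |h| := by ring

/-- **The coarse coordinate** `⌊(c·t + s)/D⌋` (Euclidean = floor division for `D > 0`). [this work] -/
def coarse (c s D : ℤ) (t : ℤ) : ℤ := (c * t + s) / D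

/-- **The coarse coordinate is 1-Lipschitz at resolution `D/c`**: `|t − t'| ≤ L` and `c·L ≤ D` give `|ρ t − ρ t'| ≤ 1` (`0 ≤ c`, `0 < D`). [folklore] -/
theorem abs_coarse_sub_le_one {c s D L t t' : ℤ} (hc : 0 ≤ c) (hD : 0 < D) (hL : c * L ≤ D) (h : |t - t'| ≤ L) :
    |coarse c s D t - coarse c s D t'| ≤ 1 := by
  -- monotone floor division: from |c t − c t'| ≤ D
  have hct : |c * t - c * t'| ≤ D := by
    rw [← mul_sub, abs_mul, abs_of_nonneg hc]
    exact (mul_le_mul_of_nonneg_left h hc).trans hL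
  rw [abs_le] at hct ⊢
  unfold coarse
  constructor
  · -- (c t' + s)/D ≤ (c t + s + D)/D = (c t + s)/D + 1
    have h1 : c * t' + s ≤ c * t + s + 1 * D := by linarith [hct.1]
    have h2 := Int.ediv_le_ediv hD h1
    rw [Int.add_mul_ediv_right _ _ hD.ne'] at h2
    linarith
  · have h1 : c * t + s ≤ c * t' + s + 1 * D := by linarith [hct.2]
    have h2 := Int.ediv_le_ediv hD h1
    rw [Int.add_mul_ediv_right _ _ hD.ne'] at h2
    linarith

/-- **The coarse skeleton `ρ ∘ φ` is 1-Lipschitz** (`Skelφ.Lip`): for a 1-Lipschitz planar map `φ`, constants `c ≥ 0`, `D > 0` with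
`c·|A|(|vβ|+|vα|) ≤ D` and `c·|A|(|n|+|h|) ≤ D`, the map `w ↦ (⌊(c λ₀(φ w) + s₀)/D⌋, ⌊(c λ₁(φ w) + s₁)/D⌋)` moves by at most one in each coordinate
along every edge — so the two-unit planar cell files apply to it verbatim. [cite: MartineauTassion2017, §4.3 (boxes B_z on the lattice z₁u + z₂v)] -/
theorem lip_coarse_comp {V : Type} {G : SimpleGraph V} {φ : V → Site 2} (hlip : Skelφ.Lip G φ) {A n h vα vβ c s₀ s₁ D : ℤ}
    (hc : 0 ≤ c) (hD : 0 < D) (hL0 : c * (|A| * (|vβ| + |vα|)) ≤ D) (hL1 : c * (|A| * (|n| + |h|)) ≤ D) :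
    Skelφ.Lip G (fun w => ![coarse c s₀ D (lam0 A vα vβ (φ w)), coarse c s₁ D (lam1 A n h (φ w))]) := by
  intro u v huv i
  have h0 := hlip huv 0
  have h1 := hlip huv 1
  fin_cases i
  · exact abs_coarse_sub_le_one hc hD hL0 (abs_lam0_sub_le A vα vβ h0 h1)
  · exact abs_coarse_sub_le_one hc hD hL1 (abs_lam1_sub_le A n h h0 h1)

/-! ## §3 Steering and the wobble bound -/

/-- **Symmetric steering** (x-family: halves `[0, W]` / `[−W, 0]` about the midpoint — MT17's re-centred parallelogram): choosing the lower half when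
the current offset is `≥ 0` and the upper half otherwise keeps the offset in `[−W, W]`. [cite: MartineauTassion2017, §4.3 Lemma 4.2] -/
theorem steer_sym {W o d : ℤ} (ho : |o| ≤ W) (hd : (0 ≤ o → -W ≤ d ∧ d ≤ 0) ∧ (o < 0 → 0 ≤ d ∧ d ≤ W)) : |o + d| ≤ W := by
  rw [abs_le] at ho ⊢
  rcases le_or_gt 0 o with h | h
  · have := hd.1 h; constructor <;> linarith [this.1, this.2]
  · have := hd.2 h; constructor <;> linarith [this.1, this.2]

/-- **Piece steering** (y′-family: pieces `[v, b]` = offset `[0, n − vα]` and `[−a, v]` = offset `[−(n + vα), 0]` along u): choosing `[−a, v]` when the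
current along-u offset `r ≥ 0` and `[v, b]` otherwise keeps `r ∈ [−(n + vα), n − vα]` — for EVERY split point `|vα| ≤ n`.
[cite: MartineauTassion2017, §4.3 Lemma 4.2 (the key geometric observation)] -/
theorem steer_pieces {n vα r d : ℤ} (hr : -(n + vα) ≤ r ∧ r ≤ n - vα)
    (hd : (0 ≤ r → -(n + vα) ≤ d ∧ d ≤ 0) ∧ (r < 0 → 0 ≤ d ∧ d ≤ n - vα)) :
    -(n + vα) ≤ r + d ∧ r + d ≤ n - vα := by
  rcases le_or_gt 0 r with h | h
  · have := hd.1 h; constructor <;> linarith [this.1, this.2]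
  · have := hd.2 h; constructor <;> linarith [this.1, this.2]

/-- The along-u steering interval lies in `[−2n, 2n]`. [folklore] -/
theorem pieces_subset_two_mul {n vα r : ℤ} (hv : |vα| ≤ n) (hr : -(n + vα) ≤ r ∧ r ≤ n - vα) : |r| ≤ 2 * n := by
  rw [abs_le] at hv ⊢; constructor <;> linarith [hr.1, hr.2]

/-- **The slant term of an x-run is at most ~one stride**: `|A·vα·J| ≤ A·n·ℓ` for a cumulative half offset `|J| ≤ ℓ`, `|vα| ≤ n`, `0 ≤ A`
(compare one stride `A·m` with `m > nℓ − n − |h|`). [folklore] -/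
theorem abs_slant_le {A n ℓ vα J : ℤ} (hA : 0 ≤ A) (hv : |vα| ≤ n) (hJ : |J| ≤ ℓ) : |A * vα * J| ≤ A * n * ℓ := by
  rw [abs_mul, abs_mul, abs_of_nonneg hA]
  have hn : 0 ≤ n := (abs_nonneg _).trans hv
  calc A * |vα| * |J| ≤ A * n * ℓ := by gcongr

/-- **The layer modulus is within `n + |h|` of `nℓ`** when `v` lies in the top layer. [folklore] -/
theorem modulus_bounds {n h ℓ vα vβ : ℤ} (hlay : n * ℓ - (n + |h|) < modulus n h vα vβ ∧ modulus n h vα vβ ≤ n * ℓ) :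
    |modulus n h vα vβ - n * ℓ| ≤ n + |h| := by
  rw [abs_le]; constructor <;> linarith [hlay.1, hlay.2]

/-! ## §4 Rounding division and the exact floor lemma -/

/-- Round-half-up integer division `⌊t/c + 1/2⌋ = (2t + c)/(2c)`. [folklore] -/
def rdiv (t c : ℤ) : ℤ := (2 * t + c) / (2 * c)

/-- The rounding error of `rdiv`: `|2(c·rdiv t c − t)| ≤ c` for `c > 0`. [folklore] -/
theorem two_mul_abs_sub_le {t c : ℤ} (hc : 0 < c) : 2 * |c * rdiv t c - t| ≤ c := by
  unfold rdiv
  set q := (2 * t + c) / (2 * c) with hq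
  have h2c : (0 : ℤ) < 2 * c := by linarith
  have hdiv := Int.mul_ediv_add_emod (2 * t + c) (2 * c)
  have hm0 := Int.emod_nonneg (2 * t + c) h2c.ne'
  have hm1 := Int.emod_lt_of_pos (2 * t + c) h2c
  rw [← hq] at hdiv
  have key : 2 * (c * q - t) = c - (2 * t + c) % (2 * c) := by linarith
  have e2 : 2 * |c * q - t| = |2 * (c * q - t)| := by rw [abs_mul, abs_two]
  rw [e2, key, abs_le]; constructor <;> linarith

/-- **Exact floor**: if `D·z ≤ a < D·z + D` (`D > 0`) then `a / D = z`. [folklore] -/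
theorem ediv_eq_of_bounds {a D z : ℤ} (hD : 0 < D) (h1 : D * z ≤ a) (h2 : a < D * z + D) : a / D = z := by
  have hdiv := Int.mul_ediv_add_emod a D
  have hm0 := Int.emod_nonneg a hD.ne'
  have hm1 := Int.emod_lt_of_pos a hD
  have hlo : D * z < D * (a / D + 1) := by linarith
  have hhi : D * (a / D) < D * (z + 1) := by linarith
  have h3 : z < a / D + 1 := lt_of_mul_lt_mul_left hlo hD.le
  have h4 : a / D < z + 1 := lt_of_mul_lt_mul_left hhi hD.le
  omega

/-! ## §5 The canonical representative of a coarse cell -/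

/-- **Canonical planar representative of coarse cell `z`**: `rep z = round(A(z₀ u + z₁ v)/c)` componentwise (`u = (n,h)`, `v = (vα,vβ)`). [this work] -/
def rep (A n h vα vβ c : ℤ) (z : Site 2) : Site 2 :=
  ![rdiv (A * (z 0 * n + z 1 * vα)) c, rdiv (A * (z 0 * h + z 1 * vβ)) c]

/-- `c·λ₀(rep z) = D·z₀ + A(vβ·e₀ − vα·e₁)` with the rounding errors `e_i = c·rep_i − A(…)`. [folklore] -/
theorem c_mul_lam0_rep (A n h vα vβ c : ℤ) (z : Site 2) :
    c * lam0 A vα vβ (rep A n h vα vβ c z) =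
      detD A n h vα vβ * z 0 +
        A * (vβ * (c * rep A n h vα vβ c z 0 - A * (z 0 * n + z 1 * vα)) - vα * (c * rep A n h vα vβ c z 1 - A * (z 0 * h + z 1 * vβ))) := by
  unfold lam0 detD modulus; ring

/-- `c·λ₁(rep z) = D·z₁ + A(n·e₁ − h·e₀)`. [folklore] -/
theorem c_mul_lam1_rep (A n h vα vβ c : ℤ) (z : Site 2) :
    c * lam1 A n h (rep A n h vα vβ c z) =
      detD A n h vα vβ * z 1 +
        A * (n * (c * rep A n h vα vβ c z 1 - A * (z 0 * h + z 1 * vβ)) - h * (c * rep A n h vα vβ c z 0 - A * (z 0 * n + z 1 * vα))) := by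
  unfold lam1 detD modulus bp; ring

/-- The two rounding errors of `rep` are at most `c/2` in absolute value (doubled form). [folklore] -/
theorem rep_err {A n h vα vβ c : ℤ} (hc : 0 < c) (z : Site 2) :
    2 * |c * rep A n h vα vβ c z 0 - A * (z 0 * n + z 1 * vα)| ≤ c ∧ 2 * |c * rep A n h vα vβ c z 1 - A * (z 0 * h + z 1 * vβ)| ≤ c := by
  unfold rep
  simp only [Matrix.cons_val_zero, Matrix.cons_val_one]
  exact ⟨two_mul_abs_sub_le hc, two_mul_abs_sub_le hc⟩

/-- A weighted rounding error: `2|A(p e₀ − q e₁)| ≤ |A|(|p|+|q|)·c` when `2|e_i| ≤ c`. [folklore] -/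
theorem two_mul_abs_comb_le {A p q e₀ e₁ c : ℤ} (h0 : 2 * |e₀| ≤ c) (h1 : 2 * |e₁| ≤ c) :
    2 * |A * (p * e₀ - q * e₁)| ≤ |A| * (|p| + |q|) * c := by
  rw [abs_mul]
  have : |p * e₀ - q * e₁| ≤ |p| * |e₀| + |q| * |e₁| := by
    calc |p * e₀ - q * e₁| ≤ |p * e₀| + |q * e₁| := abs_sub _ _
      _ = |p| * |e₀| + |q| * |e₁| := by rw [abs_mul, abs_mul]
  have hp := abs_nonneg p; have hq := abs_nonneg q; have hA := abs_nonneg A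
  nlinarith [mul_nonneg hp (abs_nonneg e₀), mul_nonneg hq (abs_nonneg e₁), mul_nonneg hA hp, mul_nonneg hA hq]

/-- From `2|y| ≤ B` to the two-sided bound on `2y`. [folklore] -/
theorem bounds_of_two_mul_abs_le {y B : ℤ} (h : 2 * |y| ≤ B) : -B ≤ 2 * y ∧ 2 * y ≤ B := by
  have h' : |2 * y| ≤ B := by rwa [abs_mul, abs_two]
  exact abs_le.mp h'

/-- **The representative lies in its cell**: `ρ_i(rep z) = z_i` (`i = 0, 1`) as soon as `c > 0`, `D > 0`, `s = D / 2` and `c·L_i + 2 ≤ D` for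
`L₀ = |A|(|vβ| + |vα|)`, `L₁ = |A|(|n| + |h|)` — the coarse skeleton hits every coarse cell. [cite: MartineauTassion2017, §4.3] -/
theorem coarse_rep {A n h vα vβ c : ℤ} (hc : 0 < c) (hD : 0 < detD A n h vα vβ)
    (hL0 : c * (|A| * (|vβ| + |vα|)) + 2 ≤ detD A n h vα vβ) (hL1 : c * (|A| * (|n| + |h|)) + 2 ≤ detD A n h vα vβ) (z : Site 2) :
    coarse c (detD A n h vα vβ / 2) (detD A n h vα vβ) (lam0 A vα vβ (rep A n h vα vβ c z)) = z 0 ∧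
      coarse c (detD A n h vα vβ / 2) (detD A n h vα vβ) (lam1 A n h (rep A n h vα vβ c z)) = z 1 := by
  set D := detD A n h vα vβ with hDdef
  obtain ⟨he0, he1⟩ := rep_err (A := A) (n := n) (h := h) (vα := vα) (vβ := vβ) hc z
  set e₀ := c * rep A n h vα vβ c z 0 - A * (z 0 * n + z 1 * vα) with he₀
  set e₁ := c * rep A n h vα vβ c z 1 - A * (z 0 * h + z 1 * vβ) with he₁
  -- the half offset
  have hs := Int.mul_ediv_add_emod D 2
  have hs0 := Int.emod_nonneg D (by norm_num : (2 : ℤ) ≠ 0)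
  have hs1 := Int.emod_lt_of_pos D (by norm_num : (0 : ℤ) < 2)
  constructor
  · have hid : c * lam0 A vα vβ (rep A n h vα vβ c z) = D * z 0 + A * (vβ * e₀ - vα * e₁) := c_mul_lam0_rep A n h vα vβ c z
    have herr := bounds_of_two_mul_abs_le (two_mul_abs_comb_le (A := A) (p := vβ) (q := vα) he0 he1)
    unfold coarse
    rw [hid]
    apply ediv_eq_of_bounds hD <;> linarith [herr.1, herr.2]
  · have hid : c * lam1 A n h (rep A n h vα vβ c z) = D * z 1 + A * (n * e₁ - h * e₀) := c_mul_lam1_rep A n h vα vβ c z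
    have herr := bounds_of_two_mul_abs_le (two_mul_abs_comb_le (A := A) (p := n) (q := h) he1 he0)
    unfold coarse
    rw [hid]
    apply ediv_eq_of_bounds hD <;> linarith [herr.1, herr.2]

/-! ## §5b Spacing of representatives -/

/-- Representatives of two cells differ by at most `(|A|·(cell-vector span) + c)/c` per coordinate: in doubled-and-cleared form,
`2c·|rep z' i − rep z i| ≤ 2|A|·|Δ| + 2c` where `Δ` is the corresponding combination of `z' − z`. [folklore] -/
theorem abs_rep_sub_rep_le {A n h vα vβ c : ℤ} (hc : 0 < c) (z z' : Site 2) :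
    2 * (c * |rep A n h vα vβ c z' 0 - rep A n h vα vβ c z 0|) ≤
        2 * |A * ((z' 0 - z 0) * n + (z' 1 - z 1) * vα)| + 2 * c ∧
      2 * (c * |rep A n h vα vβ c z' 1 - rep A n h vα vβ c z 1|) ≤
        2 * |A * ((z' 0 - z 0) * h + (z' 1 - z 1) * vβ)| + 2 * c := by
  obtain ⟨ha0, ha1⟩ := rep_err (A := A) (n := n) (h := h) (vα := vα) (vβ := vβ) hc z
  obtain ⟨hb0, hb1⟩ := rep_err (A := A) (n := n) (h := h) (vα := vα) (vβ := vβ) hc z'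
  constructor
  · have key : c * (rep A n h vα vβ c z' 0 - rep A n h vα vβ c z 0) =
        A * ((z' 0 - z 0) * n + (z' 1 - z 1) * vα) +
          ((c * rep A n h vα vβ c z' 0 - A * (z' 0 * n + z' 1 * vα)) - (c * rep A n h vα vβ c z 0 - A * (z 0 * n + z 0 * 0 + z 1 * vα))) := by
      ring
    have : c * |rep A n h vα vβ c z' 0 - rep A n h vα vβ c z 0| = |c * (rep A n h vα vβ c z' 0 - rep A n h vα vβ c z 0)| := by
      rw [abs_mul, abs_of_pos hc]
    rw [this, key]
    have t := abs_add_le (A * ((z' 0 - z 0) * n + (z' 1 - z 1) * vα))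
      ((c * rep A n h vα vβ c z' 0 - A * (z' 0 * n + z' 1 * vα)) - (c * rep A n h vα vβ c z 0 - A * (z 0 * n + z 0 * 0 + z 1 * vα)))
    have t2 := abs_sub (c * rep A n h vα vβ c z' 0 - A * (z' 0 * n + z' 1 * vα)) (c * rep A n h vα vβ c z 0 - A * (z 0 * n + z 0 * 0 + z 1 * vα))
    simp only [mul_zero, add_zero] at t t2 ⊢
    linarith
  · have key : c * (rep A n h vα vβ c z' 1 - rep A n h vα vβ c z 1) =
        A * ((z' 0 - z 0) * h + (z' 1 - z 1) * vβ) +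
          ((c * rep A n h vα vβ c z' 1 - A * (z' 0 * h + z' 1 * vβ)) - (c * rep A n h vα vβ c z 1 - A * (z 0 * h + z 1 * vβ))) := by
      ring
    have : c * |rep A n h vα vβ c z' 1 - rep A n h vα vβ c z 1| = |c * (rep A n h vα vβ c z' 1 - rep A n h vα vβ c z 1)| := by
      rw [abs_mul, abs_of_pos hc]
    rw [this, key]
    have t := abs_add_le (A * ((z' 0 - z 0) * h + (z' 1 - z 1) * vβ))
      ((c * rep A n h vα vβ c z' 1 - A * (z' 0 * h + z' 1 * vβ)) - (c * rep A n h vα vβ c z 1 - A * (z 0 * h + z 1 * vβ)))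
    have t2 := abs_sub (c * rep A n h vα vβ c z' 1 - A * (z' 0 * h + z' 1 * vβ)) (c * rep A n h vα vβ c z 1 - A * (z 0 * h + z 1 * vβ))
    linarith

/-! ## §6 COARSE STEPS: a vertex at a prescribed coarse position near any vertex -/

/-- **COARSE STEPS** (replacement of `rectCtr hstep` when a kit centre is sited by its COARSE position): for a planar map with unit steps, from every
vertex `w₀` and every coarse target `z` there is a vertex `g` with planar position the canonical representative `rep z` (hence `ρ(φ g) = z` by `coarse_rep`)
within graph distance `‖rep z − φ w₀‖₁` of `w₀`. [cite: KozmaNitzan2024, §4 Lemma 10 Step IV (pp. 20–21)] -/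
theorem exists_mem_graphBall_φ_eq_rep {V : Type} [DecidableEq V] {G : SimpleGraph V} [G.LocallyFinite] {φ : V → Site 2} (hstep : Skelφ.Steps G φ)
    (A n h vα vβ c : ℤ) (w₀ : V) (z : Site 2) :
    ∃ g, g ∈ Literature.Barriers.CriticalPhenomena.graphBall G w₀
        ((rep A n h vα vβ c z 0 - φ w₀ 0).natAbs + (rep A n h vα vβ c z 1 - φ w₀ 1).natAbs) ∧ φ g = rep A n h vα vβ c z :=
  Skelφ.exists_mem_graphBall_φ_eq hstep w₀ (rep A n h vα vβ c z)

end Para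

end TwoAxis

end Summit.CriticalPhenomena.PercolationContinuityZ3.Theorems.Transplant
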